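import Literature.Analysis.FluidPDE.PeriodicLeraySystem
import Literature.Analysis.FluidPDE.AxisymmetricHeatFlow
import HarnessLib

/-!
# Forward rotated self-similar (RSS) and rotated discretely self-similar (RDSS) solutions:
  Bradshaw–Tsai, *Rotationally corrected scaling invariant solutions to the Navier–Stokes equations*,
  Comm. PDE 42 (2017) = arXiv:1610.05680, §1: Definition 1.1 and **Theorem 1.3** (whole space)

Analysis/FluidPDE named-fact file (cell `pub-ns-dss`, lit seat: the FORWARD existence side of the
rotated-DSS objects whose BACKWARD Type I versions are the search target — the hypothesis class of
the tree theorem `Summit.NavierStokesRegularity.NavierStokesRegularity.Theorems.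
filamentSkeletonRss_rdssProfileTruncation_proof`). Everything on the backward side is in the tree
(`SelfSimilarLiouville` walls `TypeIDSSLiouville` / `RotatedTypeIDSSLiouville`, the similarity
dictionary `AncientSimilarityVariables` / `HyperbolicDSSOrbit`, Chae–Wolf 2017, Pineau–Vicol
2026); of the forward side the tree has Jia–Šverák (SS), [BT1] = Bradshaw–Tsai AHP 2017
(`bradshawTsai2017_thm_2_4`, `PeriodicLeraySystem`), Chae–Wolf 2018 and Bradshaw–Tsai 2019 (DSS) —
but NOT the rotated classes of arXiv:1610.05680, which this file vendors. Held text: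
`paper:arxiv-1610.05680` (page numbers `p.` are those of the held text = arXiv numbering).

## What is printed (§1, pp. 3–5)

* `R(s)` is the rotation of `ℝ³` about the `x₃`-axis by the angle `s` (p. 3: `R(s) = exp(sJ)`,
  `J e₁ = e₂`, `J e₂ = −e₁`, `J e₃ = 0`) — the tree's `rotZ s` / `rotZLIE s`.
* (v-RSS), p. 3: `v(x,t) = λ R(−2α log λ) v(λ R(2α log λ) x, λ²t)` for all `x`, `t` and ALL
  `λ > 0`; `α` is the angular speed. (v-RDSS), p. 3: `v(x,t) = λ R(−φ) v(λ R(φ) x, λ²t)` for all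
  `x`, `t`, for SOME `λ > 1` (the factor) and `φ ∈ ℝ` (the phase). (v0-RSS)/(v0-RDSS), p. 4: the
  same identities for a datum `v₀(x)`. "Note that an RSS vector field with angular speed `α` is
  always RDSS for any factor `λ > 1` with phase `φ = 2α log λ`" (p. 4); "When `φ ∈ 2πℤ` we recover
  `λ`-DSS vector fields" (p. 3); `SS ⊊ RSS ⊊ DSS ⊊ RDSS` (p. 4); "If `v₀` is axisymmetric … then RSS
  is reduced to SS, and RDSS is reduced to DSS" (p. 4).
* **Definition 1.1** (EP-solutions, p. 5). "Let `Ω` be a domain in `ℝ³`. The vector field `v`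
  defined on `Ω × (0,∞)` is an energy perturbed solution to (NSE) – i.e. an EP-solution – with
  initial data `v₀ ∈ L³_{w,σ}(Ω)` if `∫₀^∞ ((v, ∂ₛf) − (∇v, ∇f) − (v·∇v, f)) ds = 0` (1.14) for all
  `f ∈ {f ∈ C₀^∞(Ω × ℝ₊) : ∇·f = 0}`, if `v − Sv₀ ∈ L^∞(0,T;L²(Ω)) ∩ L²(0,T;H¹(Ω))` for any `T > 0`,
  and if `lim_{t→0⁺} ‖v(t) − Sv₀(t)‖_{L²(Ω)} = 0`, where `Sv₀(t) ∈ L^∞(0,∞;L³_{w,σ}(Ω))` is the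
  solution to the time-dependent Stokes system with initial data `v₀`." (Remark 1.2: no pressure
  is mentioned; it "can be constructed after the fact".)
* **Theorem 1.3** (p. 5). "Assume `v₀` is in `L³_{w,σ}(Ω)` where `Ω ∈ {ℝ³, ℝ³₊}`. (i) (RSS) If
  `v₀` is RSS, satisfying (v0-RSS) for some angular speed `α ∈ ℝ`, then there exists an
  EP-solution `v` on `Ω × [0,∞)` with initial data `v₀`, which is RSS and satisfies (v-RSS) for the
  same `α`. … (ii) (RDSS) If `v₀` is RDSS, satisfying (v0-RDSS) for some factor `λ > 1` and phase
  `φ ∈ ℝ`, then there exists an EP-solution `v` on `Ω × [0,∞)` with initial data `v₀`, which is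
  RDSS and satisfies (v-RDSS) for the same `λ` and `φ`. [It satisfies `v|_{∂Ω} = 0` if `Ω = ℝ³₊`.]"
  Comments (p. 5): for `α = 0` / `φ = 0` these are the `λ`-DSS solutions of [Tsai 2014, BT1].
* §3, p. 10: "when `v₀` is RDSS for given factor `λ > 1` and phase `φ` …, `Sv₀` is RDSS for the same
  values of `λ` and `φ`"; "If `v₀` is RSS with angular speed `α` …, `Sv₀` is also [RSS]".

## Rendering (whole space `Ω = ℝ³` only)

* `IsRDSSData c φ v₀`, `IsRSSData α v₀`: (v0-RDSS), (v0-RSS) verbatim, with `R(φ) = rotZLIE φ`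
  (so `R(−φ) = (rotZLIE φ).symm`, `rotZLIE_symm_apply`). RDSS FIELDS are the accepted
  `IsRotatedDSS c (rotZLIE φ) v` of `SelfSimilar.lean` (`c • R.symm (v (c²t) (c • R x)) = v t x`,
  letter for letter (v-RDSS)); `IsRSS α v` := (v-RSS) = `IsRotatedDSS c (rotZLIE (2α log c)) v` for
  every `c > 0`. Sign convention: this is Bradshaw–Tsai's; Pineau–Vicol's ansatz (tree `pvAnsatz`)
  has the opposite sign of `α` (route `FilamentSkeletonRss` quantifies `R(−2α log c)`).
* `IsEPSolution v₀ v` (Definition 1.1, `Ω = ℝ³`, where the Stokes flow of a divergence-free datum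
  is the caloric extension, `Sv₀(t) = e^{tΔ}v₀ = UnboundedOperators.heatExtension v₀ t`, §3 p. 10):
  a structure with (a) measurability of `v` on `(0,∞) × ℝ³` and weak divergence-freeness of a.e.
  slice — implicit in print ("solution to (NSE)"; the constructed `v` is the image of the periodic
  weak solution `u` of Definition 2.2, p. 7, which "is divergence free"); (b) the weak form (1.14)
  with an explicit weak spatial gradient `G = ∇v` on the open slab `(0,∞) × ℝ³`
  (`HasWeakSpatialGradientOn`; `(∇v,∇f) = ∫ frobeniusInner G Df`, `v·∇v = G v`), tested against
  divergence-free `f ∈ C_c^∞((0,∞) × ℝ³; ℝ³)`; (c) `v − Sv₀ ∈ L^∞(0,T;L²) ∩ L²(0,T;H¹)` for every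
  `T > 0` (`∀ᵐ t ∈ (0,T)` bound on `∫|v − Sv₀|²`; `∫_{(0,T)×ℝ³} (|v − Sv₀|² + |G − D(Sv₀)|²) < ∞`,
  `D(Sv₀)` the classical `fderiv` of the smooth caloric extension); (d) `∫|v(t) − Sv₀(t)|² → 0` as
  `t → 0⁺`. The half-space case and the boundary condition are not rendered
  (`-- TODO(general form): Ω = ℝ³₊`).
* Facts `bradshawTsai2017_rdss_existence` (Thm 1.3 (ii)) and `bradshawTsai2017_rss_existence`
  (Thm 1.3 (i)), `Ω = ℝ³`. `L³_w` is `FunctionSpaces.MemWeakLp · 3 volume`, `σ` is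
  `IsWeaklyDivFree` (as in the tree's [BT1] facts).
* Proved: RSS ⇒ RDSS for every factor (data and fields, p. 4), `φ = 0` ⇒ DSS (p. 3), the DSS
  corollary of Thm 1.3 (ii) (Comments, p. 5), the RDSS/RSS covariance of the Stokes (= heat) flow
  (§3, p. 10: `isRotatedDSS_heatExtension_of_isRDSSData`), the (V-RDSS) correspondence in [BT1]'s
  similarity variables (p. 4: a profile with the twisted periodicity
  `u(s, y) = R(−φ) u(s + log λ, R(φ) y)` has an RDSS physical image `physVelocity u`), and
  non-vacuity of `IsEPSolution` (zero datum).

## Mathlib / tree search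

`lean search 'RDSS|IsRotatedDSS|rotZLIE|EPSolution|BradshawTsai2017CPDE'`: `IsRotatedDSS`
(`SelfSimilar`), `rotZ`/`rotZLIE` (`AxisymmetricEuler`, `AxisymmetricVorticityTransport`), the
backward dictionary (`HyperbolicDSSOrbit`, `AncientSimilarityVariables`, `PineauVicolRDSSLeray`),
`physVelocity`/`isDiscretelySelfSimilar_physVelocity` (`PeriodicLeraySystem`),
`heatExtension_nsRescaleData` (`ForwardDSSLocalLeray`), `heatExtension_comp_linearIsometryEquiv` /
`heatExtension_continuousLinearEquiv_comp` (`AxisymmetricHeatFlow`) — reused; no prior rendering of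
arXiv:1610.05680 Def 1.1 / Thm 1.3 (the key `BradshawTsai2017CPDE` is cited in the tree only for §1's
definitions and §5's Open Problems). Mathlib has no Navier–Stokes notions.

## References

* Z. Bradshaw, T.-P. Tsai, *Rotationally corrected scaling invariant solutions to the Navier–Stokes
  equations*, Comm. PDE 42 (2017) 1065–1087 = arXiv:1610.05680: §1 pp. 3–5 ((v-RSS), (v-RDSS),
  (v0-RSS), (v0-RDSS), Definition 1.1, Remark 1.2, Theorem 1.3 and Comments), §2 p. 7 (Definition
  2.2), §3 p. 10 (RDSS covariance of `Sv₀`), §4 p. 13 (proof of Thm 1.3). [BradshawTsai2017CPDE]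
* Z. Bradshaw, T.-P. Tsai, Ann. Henri Poincaré 18 (2017) = arXiv:1510.07504, (1.6)–(1.7)
  (similarity variables `y = x/√(2t)`, `s = log √(2t)`). [BradshawTsai2017AHP]
-/

noncomputable section

open MeasureTheory Set Function Filter Topology TopologicalSpace Metric
open scoped NNReal ENNReal InnerProductSpace RealInnerProductSpace Laplacian

namespace Literature.Analysis.FluidPDE

/-- Local notation for physical space `ℝ³ = EuclideanSpace ℝ (Fin 3)`. -/
local notation "ℝ³" => EuclideanSpace ℝ (Fin 3)

/-! ## Rotated (discretely) self-similar data and fields (§1, pp. 3–4) -/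

/-- **(v0-RDSS)** (Bradshaw–Tsai 2017, §1, p. 4): the datum `v₀ : ℝ³ → ℝ³` is *rotated discretely
self-similar* with factor `c` and phase `φ` if `v₀(x) = c R(−φ) v₀(c R(φ) x)` for all `x`, where
`R(φ) = rotZLIE φ` is the rotation by `φ` about the `x₃`-axis (`R(−φ) = (rotZLIE φ).symm`). The
time-zero shape of the accepted `IsRotatedDSS c (rotZLIE φ)`. [cite: BradshawTsai2017CPDE, §1 (v0-RDSS) (arXiv:1610.05680 p. 4)] -/
def IsRDSSData (c φ : ℝ) (v₀ : ℝ³ → ℝ³) : Prop :=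
  ∀ x, c • (rotZLIE φ).symm (v₀ (c • rotZLIE φ x)) = v₀ x

/-- **(v0-RSS)** (Bradshaw–Tsai 2017, §1, p. 4): the datum `v₀` is *rotated self-similar* with
angular speed `α` if `v₀(x) = λ R(−2α log λ) v₀(λ R(2α log λ) x)` for all `x` and ALL `λ > 0`,
i.e. it is RDSS with every factor `λ > 0` and the phase `2α log λ`. [cite: BradshawTsai2017CPDE, §1 (v0-RSS) (arXiv:1610.05680 p. 4)] -/
def IsRSSData (α : ℝ) (v₀ : ℝ³ → ℝ³) : Prop :=
  ∀ c : ℝ, 0 < c → IsRDSSData c (2 * α * Real.log c) v₀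

/-- **(v-RSS)** (Bradshaw–Tsai 2017, §1, p. 3): the space–time field `v` (time first) is *rotated
self-similar* with angular speed `α` if `v(x,t) = λ R(−2α log λ) v(λ R(2α log λ) x, λ²t)` for all
`x`, `t` and ALL `λ > 0` — the accepted `IsRotatedDSS λ (rotZLIE (2α log λ)) v` for every `λ > 0`.
(RDSS fields, (v-RDSS) p. 3, ARE the accepted `IsRotatedDSS c (rotZLIE φ) v` and get no new name.)
[cite: BradshawTsai2017CPDE, §1 (v-RSS) (arXiv:1610.05680 p. 3)] -/
def IsRSS (α : ℝ) (v : ℝ → ℝ³ → ℝ³) : Prop :=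
  ∀ c : ℝ, 0 < c → IsRotatedDSS c (rotZLIE (2 * α * Real.log c)) v

/-- `rotZLIE 0` is the identity (`R(s) = exp(sJ)`, so `R(0) = I`; the tree's `rotZ_zero`). [cite: BradshawTsai2017CPDE, §1 (arXiv:1610.05680 p. 3: R(s) = exp(sJ))] -/
theorem rotZLIE_zero : rotZLIE 0 = LinearIsometryEquiv.refl ℝ ℝ³ := by
  ext x : 1
  simp [rotZLIE_apply]

/-- "Note that an RSS vector field with angular speed `α` is always RDSS for any factor `λ > 1` with
phase `φ = 2α log λ`" — data version (definitional). [cite: BradshawTsai2017CPDE, §1 (arXiv:1610.05680 p. 4)] -/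
theorem IsRSSData.isRDSSData {α : ℝ} {v₀ : ℝ³ → ℝ³} (h : IsRSSData α v₀) {c : ℝ} (hc : 0 < c) :
    IsRDSSData c (2 * α * Real.log c) v₀ :=
  h c hc

/-- An RSS field is RDSS for every factor `λ > 0` with phase `2α log λ` (definitional). [cite: BradshawTsai2017CPDE, §1 (arXiv:1610.05680 p. 4)] -/
theorem IsRSS.isRotatedDSS {α : ℝ} {v : ℝ → ℝ³ → ℝ³} (h : IsRSS α v) {c : ℝ} (hc : 0 < c) :
    IsRotatedDSS c (rotZLIE (2 * α * Real.log c)) v :=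
  h c hc

/-- "When `φ ∈ 2πℤ` we recover `λ`-DSS vector fields" — the case `φ = 0` for data: RDSS data with
phase `0` are `λ`-DSS data, `nsRescaleData c v₀ = v₀`. [cite: BradshawTsai2017CPDE, §1 (arXiv:1610.05680 p. 3)] -/
theorem isRDSSData_zero_iff {c : ℝ} {v₀ : ℝ³ → ℝ³} :
    IsRDSSData c 0 v₀ ↔ FluidPDE.nsRescaleData c v₀ = v₀ := by
  unfold IsRDSSData
  rw [rotZLIE_zero]
  -- `(refl).symm y = y` and `refl x = x` hold by `rfl`
  change (∀ x, c • v₀ (c • x) = v₀ x) ↔ _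
  simp only [funext_iff, FluidPDE.nsRescaleData_apply]

/-- The case `φ = 0` for fields: RDSS with phase `0` is plain `λ`-DSS (accepted
`isRotatedDSS_refl_iff`). [cite: BradshawTsai2017CPDE, §1 (arXiv:1610.05680 p. 3)] -/
theorem isRotatedDSS_rotZLIE_zero_iff {c : ℝ} {v : ℝ → ℝ³ → ℝ³} :
    IsRotatedDSS c (rotZLIE 0) v ↔ FluidPDE.IsDiscretelySelfSimilar c v := by
  rw [rotZLIE_zero, isRotatedDSS_refl_iff]

/-- An RSS datum with angular speed `0` is a self-similar (`(−1)`-homogeneous) datum: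
`nsRescaleData c v₀ = v₀` for every `c > 0` ("When `α = 0` it becomes SS", p. 3). [cite: BradshawTsai2017CPDE, §1 (arXiv:1610.05680 p. 3)] -/
theorem IsRSSData.nsRescaleData_of_zero {v₀ : ℝ³ → ℝ³} (h : IsRSSData 0 v₀) {c : ℝ} (hc : 0 < c) :
    FluidPDE.nsRescaleData c v₀ = v₀ := by
  have h1 := h c hc
  rw [mul_zero, zero_mul] at h1
  exact isRDSSData_zero_iff.1 h1

/-! ## The Stokes flow of RDSS data is RDSS (§3, p. 10) -/

/-- **RDSS covariance of the Stokes (= caloric) flow** (Bradshaw–Tsai 2017, §3, p. 10: "when `v₀`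
is RDSS for given factor `λ > 1` and phase `φ` …, `Sv₀` is RDSS for the same values of `λ` and
`φ`"): if `v₀(x) = c R(−φ) v₀(c R(φ) x)` then `c R(−φ) (e^{c²tΔ}v₀)(c R(φ) x) = (e^{tΔ}v₀)(x)` for
`t > 0` — from the parabolic covariance `heatExtension_nsRescaleData`, the isometry covariance
`heatExtension_comp_linearIsometryEquiv` and linearity in the datum
(`heatExtension_continuousLinearEquiv_comp`). Valid for every `v₀` and `c > 0`. [cite: BradshawTsai2017CPDE, §3 (arXiv:1610.05680 p. 10)] -/
theorem isRotatedDSS_heatExtension_of_isRDSSData {c φ : ℝ} (hc : 0 < c) {v₀ : ℝ³ → ℝ³}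
    (h : IsRDSSData c φ v₀) {t : ℝ} (ht : 0 < t) (x : ℝ³) :
    c • (rotZLIE φ).symm (UnboundedOperators.heatExtension v₀ (c ^ 2 * t) (c • rotZLIE φ x)) =
      UnboundedOperators.heatExtension v₀ t x := by
  -- the datum as a function of `x`: `v₀ = fun x => c • R⁻¹ (v₀ (c • R x))`
  have hv₀ : v₀ = fun x => c • (rotZLIE φ).symm (v₀ (c • rotZLIE φ x)) := (funext h).symm
  -- `w := R⁻¹ ∘ v₀ ∘ R`, so that `v₀ = nsRescaleData c w`
  set w : ℝ³ → ℝ³ := fun y => (rotZLIE φ).symm (v₀ (rotZLIE φ y)) with hw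
  have hv₀' : FluidPDE.nsRescaleData c w = v₀ := by
    funext x
    rw [FluidPDE.nsRescaleData_apply, hw]
    simp only [map_smul]
    exact h x
  conv_rhs => rw [← hv₀', BradshawTsai2017.heatExtension_nsRescaleData hc w ht x]
  congr 1
  -- `e^{sΔ} (R⁻¹ ∘ v₀ ∘ R) (y) = R⁻¹ (e^{sΔ} v₀ (R y))`
  rw [hw]
  have h1 := heatExtension_continuousLinearEquiv_comp
    ((rotZLIE φ).symm.toContinuousLinearEquiv) (fun y => v₀ (rotZLIE φ y)) (c ^ 2 * t) (c • x)
  have h2 := heatExtension_comp_linearIsometryEquiv (rotZLIE φ) v₀ (c ^ 2 * t) (c • x)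
  simp only [LinearIsometryEquiv.coe_toContinuousLinearEquiv] at h1
  rw [h1, h2, map_smul]

/-- The RSS case: if `v₀` is RSS with angular speed `α` then `e^{tΔ}v₀` satisfies (v-RSS) on `t > 0`
(§3, p. 10: "`Sv₀` is also [RSS] with the same `α`"). [cite: BradshawTsai2017CPDE, §3 (arXiv:1610.05680 p. 10)] -/
theorem heatExtension_rss_of_isRSSData {α : ℝ} {v₀ : ℝ³ → ℝ³} (h : IsRSSData α v₀) {c : ℝ}
    (hc : 0 < c) {t : ℝ} (ht : 0 < t) (x : ℝ³) :
    c • (rotZLIE (2 * α * Real.log c)).symm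
        (UnboundedOperators.heatExtension v₀ (c ^ 2 * t) (c • rotZLIE (2 * α * Real.log c) x)) =
      UnboundedOperators.heatExtension v₀ t x :=
  isRotatedDSS_heatExtension_of_isRDSSData hc (h c hc) ht x

/-! ## Definition 1.1: EP-solutions (whole space) -/

/-- **Bradshaw–Tsai 2017, Definition 1.1 (energy perturbed solutions, `Ω = ℝ³`).** "The vector
field `v` defined on `Ω × (0,∞)` is an energy perturbed solution to (NSE) – i.e. an EP-solution –
with initial data `v₀ ∈ L³_{w,σ}(Ω)` if `∫₀^∞ ((v,∂ₛf) − (∇v,∇f) − (v·∇v, f)) ds = 0` for all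
`f ∈ {f ∈ C₀^∞(Ω × ℝ₊) : ∇·f = 0}`, if `v − Sv₀ ∈ L^∞(0,T;L²(Ω)) ∩ L²(0,T;H¹(Ω))` for any `T > 0`,
and if `lim_{t→0⁺} ‖v(t) − Sv₀(t)‖_{L²(Ω)} = 0`, where `Sv₀(t)` … is the solution to the
time-dependent Stokes system with initial data `v₀`." Rendering for `Ω = ℝ³`, viscosity `1`: `Sv₀`
is the caloric extension `UnboundedOperators.heatExtension v₀` (§3); `∇v` is a weak spatial
gradient `G` of `v` on the open slab `(0,∞) × ℝ³` (`HasWeakSpatialGradientOn`), with which the weak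
form is written verbatim (`(∇v,∇f) = ∫ frobeniusInner G Df`, `v·∇v = G v`); measurability of `v` on
the slab and weak divergence-freeness of a.e. slice are recorded explicitly (implicit in print: the
solution is the physical image of the divergence-free periodic weak solution of Definition 2.2,
p. 7, §4 p. 13). The boundary clauses of the half-space case are not rendered.
-- TODO(general form): `Ω = ℝ³₊` with `v|_{∂Ω} = 0` and the Stokes flow in the half space.
[cite: BradshawTsai2017CPDE, Definition 1.1 (arXiv:1610.05680 p. 5)] -/
structure IsEPSolution (v₀ : ℝ³ → ℝ³) (v : ℝ → ℝ³ → ℝ³) : Prop where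
  /-- `v` is a.e.-strongly measurable on `(0,∞) × ℝ³` (implicit in print). -/
  aestronglyMeasurable : AEStronglyMeasurable (uncurry v) (volume.restrict (Ioi 0 ×ˢ univ))
  /-- `∇·v = 0`: a.e. slice `v t`, `t > 0`, is weakly divergence free (Def. 2.2: the periodic weak
  solution "is divergence free"). -/
  divFree : ∀ᵐ t ∂(volume.restrict (Ioi 0)), IsWeaklyDivFree (v t)
  /-- The weak form (1.14) with `∇v = G` a weak spatial gradient on `(0,∞) × ℝ³`, and the energy
  class `v − Sv₀ ∈ L²(0,T;H¹(ℝ³))` for every `T > 0`, written with the same `G`. -/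
  weak : ∃ G : ℝ → ℝ³ → ℝ³ →L[ℝ] ℝ³,
    HasWeakSpatialGradientOn (slab ℝ³ (Ioi 0) isOpen_Ioi) v G ∧
    (∀ f : ℝ → ℝ³ → ℝ³, IsSpaceTimeTestOn (slab ℝ³ (Ioi 0) isOpen_Ioi) f →
      (∀ s, VectorCalculus.IsDivFree (f s)) →
      ∫ s in Ioi 0, ∫ y, (⟪v s y, timeDeriv f s y⟫ - frobeniusInner (G s y) (fderiv ℝ (f s) y) -
        ⟪G s y (v s y), f s y⟫) = 0) ∧
    (∀ T : ℝ, 0 < T →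
      ∫⁻ z in Ioo 0 T ×ˢ (univ : Set ℝ³),
        (‖v z.1 z.2 - UnboundedOperators.heatExtension v₀ z.1 z.2‖ₑ ^ 2 +
          ENNReal.ofReal (frobeniusNormSq
            (G z.1 z.2 - fderiv ℝ (UnboundedOperators.heatExtension v₀ z.1) z.2))) < ⊤)
  /-- `v − Sv₀ ∈ L^∞(0,T;L²(ℝ³))` for every `T > 0`. -/
  energy : ∀ T : ℝ, 0 < T → ∃ C : ℝ≥0, ∀ᵐ t ∂(volume.restrict (Ioo 0 T)),
    ∫⁻ x, ‖v t x - UnboundedOperators.heatExtension v₀ t x‖ₑ ^ 2 ≤ C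
  /-- `lim_{t→0⁺} ‖v(t) − Sv₀(t)‖_{L²(ℝ³)} = 0`. -/
  initial : Tendsto (fun t => ∫⁻ x, ‖v t x - UnboundedOperators.heatExtension v₀ t x‖ₑ ^ 2)
    (𝓝[>] 0) (𝓝 0)

/-- **Non-vacuity of Definition 1.1**: for the zero datum the zero field is an EP-solution
(`e^{tΔ}0 = 0`, `UnboundedOperators.heatExtension_zero_fun`; `G = 0`, `hasWeakSpatialGradientOn_zero`;
every integrand vanishes). [cite: BradshawTsai2017CPDE, Definition 1.1 (arXiv:1610.05680 p. 5)] -/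
theorem isEPSolution_zero : IsEPSolution (0 : ℝ³ → ℝ³) (0 : ℝ → ℝ³ → ℝ³) where
  aestronglyMeasurable := by
    rw [uncurry_zero]
    exact aestronglyMeasurable_const
  divFree := Eventually.of_forall fun t θ _ => by simp
  weak := by
    have h0 : ∀ t : ℝ, UnboundedOperators.heatExtension (0 : ℝ³ → ℝ³) t = 0 := fun t =>
      UnboundedOperators.heatExtension_zero_fun t
    refine ⟨0, hasWeakSpatialGradientOn_zero _, fun f _ _ => ?_, fun T _ => ?_⟩
    · simp [frobeniusInner]
    · simp [h0, frobeniusNormSq_zero]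
  energy T _ := ⟨0, Eventually.of_forall fun t => by
    simp [show UnboundedOperators.heatExtension (0 : ℝ³ → ℝ³) t = 0 from
      UnboundedOperators.heatExtension_zero_fun t]⟩
  initial := by
    have h0 : (fun t : ℝ => ∫⁻ x : ℝ³, ‖(0 : ℝ → ℝ³ → ℝ³) t x -
        UnboundedOperators.heatExtension (0 : ℝ³ → ℝ³) t x‖ₑ ^ 2) = fun _ => 0 := by
      funext t
      simp [show UnboundedOperators.heatExtension (0 : ℝ³ → ℝ³) t = 0 from
        UnboundedOperators.heatExtension_zero_fun t]
    rw [h0]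
    exact tendsto_const_nhds

/-! ## Theorem 1.3 (whole space) -/

/-- **Bradshaw–Tsai 2017, Theorem 1.3 (ii) (RDSS), `Ω = ℝ³`.** "Assume `v₀` is in `L³_{w,σ}(Ω)` …
(ii) (RDSS) If `v₀` is RDSS, satisfying (v0-RDSS) for some factor `λ > 1` and phase `φ ∈ ℝ`, then
there exists an EP-solution `v` on `Ω × [0,∞)` with initial data `v₀`, which is RDSS and satisfies
(v-RDSS) for the same `λ` and `φ`." Statement: for `1 < c`, `φ : ℝ` and `v₀ ∈ L³_w(ℝ³)`
(`FunctionSpaces.MemWeakLp v₀ 3 volume`), weakly divergence free, with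
`v₀(x) = c R(−φ) v₀(c R(φ) x)` (`IsRDSSData c φ v₀`), there is `v` with `IsEPSolution v₀ v`
(Definition 1.1) and `c R(−φ) v(c²t, c R(φ) x) = v(t,x)` for all `t`, `x`
(`IsRotatedDSS c (rotZLIE φ) v`; imposed at all times — for `t ≤ 0` choose the extension by `0`, no
clause of `IsEPSolution` sees `t ≤ 0`). The half-space case is not rendered. [cite: BradshawTsai2017CPDE, Theorem 1.3 (ii) (arXiv:1610.05680 p. 5)] -/
def bradshawTsai2017_rdss_existence : Prop :=
  ∀ {c φ : ℝ}, 1 < c → ∀ {v₀ : ℝ³ → ℝ³}, FunctionSpaces.MemWeakLp v₀ 3 volume →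
    IsWeaklyDivFree v₀ → IsRDSSData c φ v₀ →
    ∃ v : ℝ → ℝ³ → ℝ³, IsEPSolution v₀ v ∧ IsRotatedDSS c (rotZLIE φ) v

/-- **Bradshaw–Tsai 2017, Theorem 1.3 (i) (RSS), `Ω = ℝ³`.** "(i) (RSS) If `v₀` is RSS, satisfying
(v0-RSS) for some angular speed `α ∈ ℝ`, then there exists an EP-solution `v` on `Ω × [0,∞)` with
initial data `v₀`, which is RSS and satisfies (v-RSS) for the same `α`." Statement: for `α : ℝ` and
`v₀ ∈ L³_w(ℝ³)`, weakly divergence free and RSS with angular speed `α` (`IsRSSData α v₀`), there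
is `v` with `IsEPSolution v₀ v` and `v(x,t) = λ R(−2α log λ) v(λ R(2α log λ) x, λ²t)` for all `x`,
`t` and all `λ > 0` (`IsRSS α v`). (Such `v` is Perelman's forward rotated self-similar ansatz,
p. 4: "The ansatz of RSS solutions was originally proposed by Grisha Perelman for backward
solutions".) [cite: BradshawTsai2017CPDE, Theorem 1.3 (i) (arXiv:1610.05680 p. 5)] -/
def bradshawTsai2017_rss_existence : Prop :=
  ∀ {α : ℝ} {v₀ : ℝ³ → ℝ³}, FunctionSpaces.MemWeakLp v₀ 3 volume →
    IsWeaklyDivFree v₀ → IsRSSData α v₀ →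
    ∃ v : ℝ → ℝ³ → ℝ³, IsEPSolution v₀ v ∧ IsRSS α v

/-- **The DSS case of Theorem 1.3** (Comments on Theorem 1.3, p. 5: "If `α = 0` then the class of
RDSS solutions coincides with the class of `λ`-DSS solutions defined in [Tsai-DSSI, BT1] … Theorem
1.3 therefore provides a construction of `λ`-DSS solutions … for any divergence free `λ`-DSS initial
data belonging to `L³_{w,σ}(Ω)`"): under the fact, every divergence-free `λ`-DSS `v₀ ∈ L³_w(ℝ³)` has
a `λ`-DSS EP-solution. [cite: BradshawTsai2017CPDE, Comments on Theorem 1.3 (arXiv:1610.05680 p. 5)] -/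
theorem bradshawTsai2017_rdss_existence.dss (h : bradshawTsai2017_rdss_existence) {c : ℝ}
    (hc : 1 < c) {v₀ : ℝ³ → ℝ³} (hw : FunctionSpaces.MemWeakLp v₀ 3 volume)
    (hdiv : IsWeaklyDivFree v₀) (hdss : FluidPDE.nsRescaleData c v₀ = v₀) :
    ∃ v : ℝ → ℝ³ → ℝ³, IsEPSolution v₀ v ∧ FluidPDE.IsDiscretelySelfSimilar c v := by
  obtain ⟨v, hv, hrdss⟩ := h hc hw hdiv (isRDSSData_zero_iff.2 hdss)
  exact ⟨v, hv, isRotatedDSS_rotZLIE_zero_iff.1 hrdss⟩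

/-- Under Theorem 1.3 (i), the RSS solution is RDSS for every factor `λ > 1` with phase `2α log λ`
(Comments on Theorem 1.3, second item, p. 5; p. 4). [cite: BradshawTsai2017CPDE, Comments on Theorem 1.3 (arXiv:1610.05680 p. 5)] -/
theorem bradshawTsai2017_rss_existence.isRotatedDSS (h : bradshawTsai2017_rss_existence) {α : ℝ}
    {v₀ : ℝ³ → ℝ³} (hw : FunctionSpaces.MemWeakLp v₀ 3 volume) (hdiv : IsWeaklyDivFree v₀)
    (hrss : IsRSSData α v₀) {c : ℝ} (hc : 1 < c) :
    ∃ v : ℝ → ℝ³ → ℝ³, IsEPSolution v₀ v ∧ IsRotatedDSS c (rotZLIE (2 * α * Real.log c)) v := by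
  obtain ⟨v, hv, hr⟩ := h hw hdiv hrss
  exact ⟨v, hv, hr c (zero_lt_one.trans hc)⟩

/-! ## (V-RDSS): twisted-periodic profiles have RDSS physical images ([BT1] variables) -/

/-- **(V-RDSS) in the similarity variables of [BT1]** (Bradshaw–Tsai 2017, §1, p. 4: "an RDSS
solution `v(x,t)` … with factor `λ` and phase `φ` corresponds to a solution of [the Leray equations]
satisfying `V(z,s) = R(−φ) V(R(φ)z, s + 2 log λ)`", there with `s = log t`; here in [BT1]'s
variables `y = x/√(2t)`, `s = log √(2t)`, where the period is `log λ`): if the profile `u` obeys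
the twisted periodicity `u(s, y) = R(−φ) u(s + log λ, R(φ) y)` (verbatim (V-RDSS) with period
`log λ` in these variables) then its physical image
`v = physVelocity u` (`v(x,t) = u(y,s)/√(2t)`, extended by `0` to `t ≤ 0`) is RDSS,
`λ R(−φ) v(λ²t, λR(φ)x) = v(t,x)` on `ℝ × ℝ³`. The case `φ = 0` is the tree's
`BradshawTsai2017.isDiscretelySelfSimilar_physVelocity`. [cite: BradshawTsai2017CPDE, §1 (V-RDSS) (arXiv:1610.05680 p. 4)] -/
theorem isRotatedDSS_physVelocity {c φ : ℝ} (hc : 0 < c) {u : ℝ → ℝ³ → ℝ³}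
    (hu : ∀ s y, u s y = (rotZLIE φ).symm (u (s + Real.log c) (rotZLIE φ y))) :
    IsRotatedDSS c (rotZLIE φ) (BradshawTsai2017.physVelocity u) := by
  -- the twisted periodicity solved for the later slice: `u(s + log c, z) = R (u(s, R⁻¹ z))`
  have hu' : ∀ s z, u (s + Real.log c) z = rotZLIE φ (u s ((rotZLIE φ).symm z)) := fun s z => by
    rw [hu s ((rotZLIE φ).symm z), LinearIsometryEquiv.apply_symm_apply,
      LinearIsometryEquiv.apply_symm_apply]
  intro t x
  by_cases ht : 0 < t
  · have ht' : 0 < c ^ 2 * t := mul_pos (pow_pos hc 2) ht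
    have hsq : 0 < Real.sqrt (2 * t) := Real.sqrt_pos.2 (by linarith)
    have hsqrt : Real.sqrt (2 * (c ^ 2 * t)) = c * Real.sqrt (2 * t) := by
      rw [show 2 * (c ^ 2 * t) = c ^ 2 * (2 * t) by ring, Real.sqrt_mul (sq_nonneg c),
        Real.sqrt_sq hc.le]
    have hlog : Real.log (c * Real.sqrt (2 * t)) = Real.log (Real.sqrt (2 * t)) + Real.log c := by
      rw [Real.log_mul hc.ne' hsq.ne', add_comm]
    simp only [BradshawTsai2017.physVelocity, if_pos ht, if_pos ht', hsqrt, hlog, hu', map_smul,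
      LinearIsometryEquiv.symm_apply_apply, smul_smul, mul_inv_rev]
    have hcc : c * ((Real.sqrt (2 * t))⁻¹ * c⁻¹) = (Real.sqrt (2 * t))⁻¹ := by
      field_simp
    have hcc' : (Real.sqrt (2 * t))⁻¹ * c⁻¹ * c = (Real.sqrt (2 * t))⁻¹ := by
      field_simp
    rw [hcc, hcc']
  · have ht' : ¬ 0 < c ^ 2 * t := fun h => ht (pos_of_mul_pos_right h (sq_nonneg c))
    simp only [BradshawTsai2017.physVelocity, if_neg ht, if_neg ht', map_zero, smul_zero]

end Literature.Analysis.FluidPDE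

end
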